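import Mathlib
import Literature.NumberTheory.LFunctions.KloostermanQuadraticTwist
import Literature.NumberTheory.GaussSums.GaussJacobiPrime
import HarnessLib

/-!
# The twisted second moment of Kloosterman sums `∑_c θ(c) S(1,c;p)²` — ELEMENTARY EVALUATION, PROVED

Topic `NumberTheory/GaussSums`.  For a prime `p`, `e(x) = exp(2πix/p)`,
`K(c) = S(1, c; p) = ∑_{x ≠ 0} e(x + c x̄)` (the tree's
`Literature.NumberTheory.LFunctions.kloostermanSum p 1 c`) and a non-trivial multiplicative
character `θ` of `ℤ/pℤ` we prove the classical closed form

  `∑_c θ(c) K(c)² = g(θ)² · θ(−1) · J(θ, θ⁻²)`        (`sum_mulChar_mul_kloostermanSum_sq`)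

(`g` = Gauss sum, `J` = Jacobi sum): open `K(c)²` as a sum over `x, y ≠ 0`, execute the sum over
`c` (a shifted Gauss sum), substitute `y = xt` and execute the sum over `x` (another Gauss sum),
and recognise `∑_t θ(t) θ⁻²(1 + t) = θ(−1) J(θ, θ⁻²)`.  Consequently
`|∑_c θ(c) K(c)²| ≤ p^{3/2}` as soon as `θ ≠ 1` and `θ² ≠ 1` (`norm_sum_mulChar_mul_kloostermanSum_sq_le`),
and, writing an even character as a square `ψ = η²` and `∑_b F(b²) = ∑_c (1 + χ(c)) F(c)`,

  `|∑_b ψ(b) K(b²)²| ≤ 2 p^{3/2}`   for every `ψ ≠ 1`   (`norm_sum_mulChar_mul_kloostermanSum_sq_sq_le`),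

which is the statement Kunisky–Yu 2022 quote as Proposition 4.12 from C. Liu, *Twisted higher
moments of Kloosterman sums*, Proc. AMS 130 (2002) [Liu02] (there obtained from deeper results);
the present proof uses only Gauss and Jacobi sums (`|g| = |J| = √p`).  It is the input for
Kunisky–Yu's Theorem 4.22 (`Literature/Combinatorics/SimpleGraph/PaleyT441CharSum.lean`).

## References

* C. Liu, *Twisted higher moments of Kloosterman sums*, Proc. Amer. Math. Soc. 130 (2002),
  1887–1892.
* D. Kunisky, X. Yu, arXiv:2211.02713 (2022), Proposition 4.12.  [KuniskyYu2022]
* K. Ireland, M. Rosen, *A Classical Introduction to Modern Number Theory*, Ch. 8.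
-/

noncomputable section

open Finset
open Literature.NumberTheory.LFunctions
open Literature.NumberTheory.Sieve.FriedlanderIwaniecPrimes

namespace Literature.NumberTheory.GaussSums

section Prime

variable {p : ℕ} [hp : Fact p.Prime]

/-- The Kloosterman sum with an explicit indicator: `K(c) = ∑_x [x ≠ 0] e(x + c x⁻¹)`. [folklore] -/
theorem kloostermanSum_one_eq_sum_ite (c : ZMod p) :
    kloostermanSum p 1 c =
      ∑ x : ZMod p, (if x = 0 then (0 : ℂ) else 1) * ZMod.stdAddChar (x + c * x⁻¹) := by
  classical
  unfold kloostermanSum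
  refine Finset.sum_congr rfl fun x _ => ?_
  by_cases hx : x = 0
  · subst hx; simp
  · rw [if_pos (isUnit_iff_ne_zero.mpr hx), if_neg hx, one_mul, one_mul]

/-- `K(c)²` opened as a double sum: `K(c)² = ∑_{x,y ≠ 0} e(x + y) e(c (x⁻¹ + y⁻¹))`. [folklore] -/
theorem kloostermanSum_one_sq_eq (c : ZMod p) :
    kloostermanSum p 1 c ^ 2 = ∑ x : ZMod p, ∑ y : ZMod p,
      (if x = 0 then (0 : ℂ) else 1) * (if y = 0 then (0 : ℂ) else 1) *
        (ZMod.stdAddChar (x + y) * ZMod.stdAddChar (c * (x⁻¹ + y⁻¹))) := by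
  rw [sq, kloostermanSum_one_eq_sum_ite, Finset.sum_mul_sum]
  refine Finset.sum_congr rfl fun x _ => Finset.sum_congr rfl fun y _ => ?_
  have he : (ZMod.stdAddChar (x + c * x⁻¹) : ℂ) * ZMod.stdAddChar (y + c * y⁻¹) =
      ZMod.stdAddChar (x + y) * ZMod.stdAddChar (c * (x⁻¹ + y⁻¹)) := by
    rw [← AddChar.map_add_eq_mul, ← AddChar.map_add_eq_mul]
    congr 1
    ring
  rw [← he]
  ring

/-- **The twisted second moment of Kloosterman sums** (elementary form of Liu 2002 /
Kunisky–Yu 2022, Proposition 4.12): for a non-trivial character `θ` of `ℤ/pℤ`,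
`∑_c θ(c) K(c)² = g(θ)² θ(−1) J(θ, θ⁻²)`. [cite: KuniskyYu2022, Proposition 4.12] -/
theorem sum_mulChar_mul_kloostermanSum_sq {θ : MulChar (ZMod p) ℂ} (hθ : θ ≠ 1) :
    ∑ c : ZMod p, θ c * kloostermanSum p 1 c ^ 2 =
      gaussSum θ (ZMod.stdAddChar (N := p)) ^ 2 * θ (-1) * jacobiSum θ (θ⁻¹ * θ⁻¹) := by
  classical
  set G : ℂ := gaussSum θ (ZMod.stdAddChar (N := p)) with hG
  set ι : ZMod p → ℂ := fun x => if x = 0 then 0 else 1 with hι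
  have hι0 : ∀ x : ZMod p, x = 0 → ι x = 0 := fun x hx => by rw [hι]; simp [hx]
  have hι1 : ∀ x : ZMod p, x ≠ 0 → ι x = 1 := fun x hx => by rw [hι]; simp [hx]
  have hιθ : ∀ x : ZMod p, ι x * θ x = θ x := by
    intro x
    by_cases hx : x = 0
    · rw [hx, MulChar.map_zero, mul_zero]
    · rw [hι1 x hx, one_mul]
  -- Step 1: sum over `c` first (shifted Gauss sum)
  have h1 : ∑ c : ZMod p, θ c * kloostermanSum p 1 c ^ 2 =
      G * ∑ x : ZMod p, ∑ y : ZMod p,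
        ι x * ι y * ZMod.stdAddChar (x + y) * θ⁻¹ (x⁻¹ + y⁻¹) := by
    simp_rw [kloostermanSum_one_sq_eq]
    rw [Finset.mul_sum]
    have hswap : ∑ c : ZMod p, θ c * ∑ x : ZMod p, ∑ y : ZMod p,
        ι x * ι y * ((ZMod.stdAddChar (x + y) : ℂ) * ZMod.stdAddChar (c * (x⁻¹ + y⁻¹))) =
        ∑ x : ZMod p, ∑ y : ZMod p, ι x * ι y * ZMod.stdAddChar (x + y) *
          ∑ c : ZMod p, θ c * ZMod.stdAddChar (c * (x⁻¹ + y⁻¹)) := by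
      simp_rw [Finset.mul_sum]
      rw [Finset.sum_comm]
      refine Finset.sum_congr rfl fun x _ => ?_
      rw [Finset.sum_comm]
      refine Finset.sum_congr rfl fun y _ => ?_
      refine Finset.sum_congr rfl fun c _ => ?_
      ring
    rw [hswap]
    refine Finset.sum_congr rfl fun x _ => ?_
    rw [Finset.mul_sum]
    refine Finset.sum_congr rfl fun y _ => ?_
    rw [sum_mulChar_mul_stdAddChar_mul hθ]
    ring
  -- Step 2: for each `x`, substitute `y = x t`
  have hinner : ∀ x : ZMod p, ∑ y : ZMod p,
      ι x * ι y * ZMod.stdAddChar (x + y) * θ⁻¹ (x⁻¹ + y⁻¹) =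
      θ x * ∑ t : ZMod p, θ t * θ⁻¹ (1 + t) * ZMod.stdAddChar (x * (1 + t)) := by
    intro x
    by_cases hx : x = 0
    · rw [hx, MulChar.map_zero, zero_mul]
      refine Finset.sum_eq_zero fun y _ => ?_
      rw [hι0 0 rfl]
      ring
    rw [Finset.mul_sum]
    refine (Fintype.sum_bijective (x * ·) (mulLeft_bijective₀ x hx) _ _ fun t => ?_).symm
    show θ x * (θ t * θ⁻¹ (1 + t) * ZMod.stdAddChar (x * (1 + t))) =
      ι x * ι (x * t) * ZMod.stdAddChar (x + x * t) * θ⁻¹ (x⁻¹ + (x * t)⁻¹)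
    by_cases ht : t = 0
    · subst ht
      simp only [mul_zero, hι0 0 rfl, MulChar.map_zero, zero_mul]
    rw [hι1 x hx, hι1 (x * t) (mul_ne_zero hx ht)]
    have hw : x⁻¹ + (x * t)⁻¹ = (x * t)⁻¹ * (1 + t) := by
      field_simp
      ring
    rw [hw, _root_.map_mul θ⁻¹ ((x * t)⁻¹) (1 + t), MulChar.inv_apply' θ (x * t)⁻¹, inv_inv,
      _root_.map_mul θ x t, show x + x * t = x * (1 + t) by ring]
    ring
  -- Step 3: sum over `x` (another shifted Gauss sum)
  have hT : ∑ x : ZMod p, ∑ y : ZMod p,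
      ι x * ι y * ZMod.stdAddChar (x + y) * θ⁻¹ (x⁻¹ + y⁻¹) =
      G * ∑ t : ZMod p, θ t * (θ⁻¹ * θ⁻¹) (1 + t) := by
    simp_rw [hinner]
    simp_rw [Finset.mul_sum]
    rw [Finset.sum_comm]
    refine Finset.sum_congr rfl fun t _ => ?_
    have h3 : ∑ x : ZMod p, θ x * (θ t * θ⁻¹ (1 + t) * ZMod.stdAddChar (x * (1 + t))) =
        θ t * θ⁻¹ (1 + t) * ∑ x : ZMod p, θ x * ZMod.stdAddChar (x * (1 + t)) := by
      rw [Finset.mul_sum]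
      refine Finset.sum_congr rfl fun x _ => ?_
      ring
    rw [h3, sum_mulChar_mul_stdAddChar_mul hθ (1 + t), MulChar.mul_apply]
    ring
  -- Step 4: `∑_t θ(t) θ⁻²(1+t) = θ(-1) J(θ, θ⁻²)` (substitute `t = -u`)
  have hJ : ∑ t : ZMod p, θ t * (θ⁻¹ * θ⁻¹) (1 + t) = θ (-1) * jacobiSum θ (θ⁻¹ * θ⁻¹) := by
    unfold jacobiSum
    rw [Finset.mul_sum]
    refine (Fintype.sum_equiv (Equiv.neg (ZMod p)) _ _ fun u => ?_).symm
    rw [Equiv.neg_apply]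
    have : θ (-u) = θ (-1) * θ u := by
      rw [← map_mul]
      congr 1
      ring
    rw [this, show (1 : ZMod p) + -u = 1 - u by ring]
    ring
  rw [h1, hT, hJ]
  ring

/-- **`|∑_c θ(c) K(c)²| ≤ p^{3/2}`** for `θ ≠ 1`, `θ² ≠ 1` (from `|g(θ)|² = p`, `|J| = √p`).
[cite: KuniskyYu2022, Proposition 4.12] -/
theorem norm_sum_mulChar_mul_kloostermanSum_sq_le {θ : MulChar (ZMod p) ℂ} (hθ : θ ≠ 1)
    (hθ2 : θ * θ ≠ 1) :
    ‖∑ c : ZMod p, θ c * kloostermanSum p 1 c ^ 2‖ ≤ (p : ℝ) * Real.sqrt p := by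
  rw [sum_mulChar_mul_kloostermanSum_sq hθ, norm_mul, norm_mul, norm_pow,
    norm_sq_gaussSum_stdAddChar hθ]
  have hii : θ⁻¹ * θ⁻¹ ≠ 1 := by
    intro h
    apply hθ2
    have h' : θ * θ * (θ⁻¹ * θ⁻¹) = 1 := by
      rw [show θ * θ * (θ⁻¹ * θ⁻¹) = (θ * θ⁻¹) * (θ * θ⁻¹) by
        simp only [mul_comm, mul_left_comm, mul_assoc], mul_inv_cancel, one_mul]
    rw [h, mul_one] at h'
    exact h'
  have hJ : ‖jacobiSum θ (θ⁻¹ * θ⁻¹)‖ = Real.sqrt p := by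
    refine norm_jacobiSum hθ hii ?_
    rw [← mul_assoc, mul_inv_cancel, one_mul]
    intro h
    exact hθ (inv_eq_one.mp h)
  rw [hJ]
  have h1 : ‖θ (-1)‖ ≤ 1 := norm_mulChar_apply_le_one θ (-1)
  have hp0 : (0 : ℝ) ≤ p := Nat.cast_nonneg p
  have hs0 : (0 : ℝ) ≤ Real.sqrt p := Real.sqrt_nonneg p
  calc (p : ℝ) * ‖θ (-1)‖ * Real.sqrt p ≤ (p : ℝ) * 1 * Real.sqrt p := by
        gcongr
    _ = (p : ℝ) * Real.sqrt p := by ring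

/-- **Liu's bound / Kunisky–Yu 2022, Proposition 4.12** (as printed: "For any non-trivial
multiplicative character `φ`, `|∑_a φ(a) K(a²)²| ≤ 2 p^{3/2}`"), here with an elementary proof:
odd `φ` give `0` (`a ↦ −a`); an even `φ ≠ 1` is a square `η²` (`p` odd), and
`∑_a η(a²) K(a²)² = ∑_c (1 + χ(c)) η(c) K(c)²` is a sum of two twisted second moments, each of
modulus `≤ p^{3/2}`. [cite: KuniskyYu2022, Proposition 4.12] -/
theorem norm_sum_mulChar_mul_kloostermanSum_sq_sq_le (hp2 : p ≠ 2) {ψ : MulChar (ZMod p) ℂ}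
    (hψ : ψ ≠ 1) :
    ‖∑ a : ZMod p, ψ a * kloostermanSum p 1 (a ^ 2) ^ 2‖ ≤ 2 * ((p : ℝ) * Real.sqrt p) := by
  classical
  have hp0 : (0 : ℝ) ≤ (p : ℝ) * Real.sqrt p := by positivity
  rcases mulChar_neg_one_eq_one_or ψ with heven | hodd
  · -- even: `ψ = η²`
    obtain ⟨η, hη⟩ := MulChar.exists_mul_self_eq_of_apply_neg_one hp2 ψ heven
    have hη1 : η ≠ 1 := by
      rintro rfl
      rw [mul_one] at hη
      exact hψ hη.symm
    have hη2 : η * η ≠ 1 := by rw [hη]; exact hψ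
    -- rewrite `ψ(a) = η(a²)` and resum over squares
    have h1 : ∑ a : ZMod p, ψ a * kloostermanSum p 1 (a ^ 2) ^ 2 =
        ∑ c : ZMod p, ((quadraticChar (ZMod p) c : ℂ) + 1) *
          (η c * kloostermanSum p 1 c ^ 2) := by
      rw [← sum_comp_sq_eq_sum_quadraticChar_add_one_mul hp2
        (fun c => η c * kloostermanSum p 1 c ^ 2)]
      refine Finset.sum_congr rfl fun a _ => ?_
      rw [← hη, MulChar.mul_apply, ← _root_.map_mul η a a, ← sq a]
    rw [h1]
    -- split `(χ(c) + 1) η(c) K² = (χ̃ η)(c) K² + η(c) K²`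
    set χc : MulChar (ZMod p) ℂ := (quadraticChar (ZMod p)).ringHomComp (Int.castRingHom ℂ)
      with hχc
    have h2 : ∑ c : ZMod p, ((quadraticChar (ZMod p) c : ℂ) + 1) *
        (η c * kloostermanSum p 1 c ^ 2) =
        ∑ c : ZMod p, (χc * η) c * kloostermanSum p 1 c ^ 2 +
          ∑ c : ZMod p, η c * kloostermanSum p 1 c ^ 2 := by
      rw [← Finset.sum_add_distrib]
      refine Finset.sum_congr rfl fun c _ => ?_
      rw [MulChar.mul_apply, hχc, quadraticChar_ringHomComp_apply]
      ring
    rw [h2]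
    have hθ1 : χc * η ≠ 1 := by
      intro h
      apply hψ
      have hηinv : η = χc⁻¹ := eq_inv_of_mul_eq_one_right h
      rw [← hη, hηinv, ← mul_inv, quadraticChar_ringHomComp_mul_self, inv_one]
    have hθ2 : χc * η * (χc * η) ≠ 1 := by
      rw [show χc * η * (χc * η) = (χc * χc) * (η * η) by
        simp only [mul_comm, mul_left_comm, mul_assoc], quadraticChar_ringHomComp_mul_self,
        one_mul, hη]
      exact hψ
    calc ‖∑ c : ZMod p, (χc * η) c * kloostermanSum p 1 c ^ 2 +
          ∑ c : ZMod p, η c * kloostermanSum p 1 c ^ 2‖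
        ≤ ‖∑ c : ZMod p, (χc * η) c * kloostermanSum p 1 c ^ 2‖ +
          ‖∑ c : ZMod p, η c * kloostermanSum p 1 c ^ 2‖ := norm_add_le _ _
      _ ≤ (p : ℝ) * Real.sqrt p + (p : ℝ) * Real.sqrt p :=
          add_le_add (norm_sum_mulChar_mul_kloostermanSum_sq_le hθ1 hθ2)
            (norm_sum_mulChar_mul_kloostermanSum_sq_le hη1 hη2)
      _ = 2 * ((p : ℝ) * Real.sqrt p) := by ring
  · -- odd: the sum vanishes
    have hS : ∑ a : ZMod p, ψ a * kloostermanSum p 1 (a ^ 2) ^ 2 =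
        -∑ a : ZMod p, ψ a * kloostermanSum p 1 (a ^ 2) ^ 2 := by
      conv_lhs => rw [← Equiv.sum_comp (Equiv.neg (ZMod p))]
      rw [← Finset.sum_neg_distrib]
      refine Finset.sum_congr rfl fun a _ => ?_
      rw [Equiv.neg_apply, neg_sq, show -a = -1 * a by ring, map_mul, hodd]
      ring
    have h0 : ∑ a : ZMod p, ψ a * kloostermanSum p 1 (a ^ 2) ^ 2 = 0 := by
      have := hS
      linear_combination this / 2
    rw [h0, norm_zero]
    positivity

end Prime

end Literature.NumberTheory.GaussSums

end
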